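import Summits.QuantumFields.YangMills.Theorems.UnitScaleTiltProp7OneFormAgmon
import Summits.QuantumFields.YangMills.Theorems.UnitScaleTiltProp7LaplaceAFlatLetters
import Literature.MathematicalPhysics.QuantumFieldTheory.Balaban1983to89.Beta.CombesThomasForm
import HarnessLib

/-!
# Route `UnitScaleTilt`, crux K1 «MinimiserStabilityRegPr» (stmt-QuantumFields-19200), EX face S45 — (L3′b), ONE-FORM STOREY, (P-1FA) FILE A4:
# **EXPONENTIAL WEIGHTS AND THE BLOCK-`L²` DECAY OF THE ONE-FORM GREEN's FUNCTION** — A3 ✓`agmon_oneForm_of_letters` at `w = e^{φ}` with `|φ(b₊) − φ(b₋)| ≤ θ`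
# (`ρ = e^{θ} − 1`; slope `θ = μη` ⟹ `3η⁻²ρ² ≤ 3e²μ²`, K-FREE), and its SET-TO-SET reading: for a source `f` supported where `φ = 0` and a target set of bonds where `φ ≥ R`,
# `Θ·‖𝟙_S u‖ ≤ e^{−R}·‖f‖` — [Balaban1985BackgroundPropagators] (3.46)-class decay of `G = Δ_a⁻¹` at the member, modulo A3's three form letters

Cell `ym3-torus` (HUMAN RULING D-0037; rung R3 = SU(2) YM₃ on T³ — NOT d = 4, NOT infinite volume, NOT a mass gap, NOT Clay).  Chair seat ★`ym-ust-19200-p1` g26, own pen (P-1FA) A4.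
THEOREMS ONLY (0 `def`, 0 `sorry`, default heartbeats); `--supports stmt-QuantumFields-19200 --as helper`; count-neutral.

WHAT IS PROVED (ns `Summit.QuantumFields.YangMills.Theorems.Prop7OneFormAgmonExp`).
* §1 `ratio_exp_le`∕`ratio_exp_le'` (the two bond-ratio letters of A3 for `w = e^{φ}`; lit ✓`Beta.CombesThomasForm.abs_exp_sub_one_le`).
* §2 ★★ `agmon_oneForm_exp` — A3 at `w = e^{φ}`: `((1−ε)γ − εC_V − 3η⁻²(e^θ − 1)²(1+1∕ε) − θ_V)·‖e^{φ∘src}·u‖ ≤ ‖e^{φ∘src}·f‖`.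
* §3 `norm_toL2_indicator_le_exp_neg_mul` (`φ∘src ≥ R` on `S` ⟹ `‖𝟙_S X‖ ≤ e^{−R}‖e^{φ∘src}·X‖`), `toL2_smul_eq_of_support` (`φ∘src = 0` on `supp X` ⟹ `e^{φ∘src}·X = X`),
  ★★★ `blockDecay_oneForm_of_letters` — `Θ·‖toL2(𝟙_S · toL2⁻¹u)‖ ≤ e^{−R}·‖f‖` for `Δ_a u = f`, `f` supported in `{φ∘src = 0}`, `φ∘src ≥ R` on `S`: the set-to-set decay the pointwise edition
  (O4, V4's pattern) and the row sums of `norm_G`∕`norm_H` consume; with `φ = μη·dist_fine(·, B_y)` truncated, `R = μ·(tdist(B, B_y) − 1)`-class.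
HONEST SCOPE.  Bookkeeping over A3; CONDITIONAL on A3's (γ)(C_V)(θ_V); nothing of the ten EX rows, `hT`, (3.46) for print's operators, EX or the crux is proved here.

References: T. Bałaban, CMP **99** (1985) 389–434 [Balaban1985BackgroundPropagators] (Thm 3.1 (3.46) p.398, Thm 3.12 p.422); S. Agmon, *Lectures on exponential decay* (1982) Ch. 1 [folklore].
-/

set_option autoImplicit false

noncomputable section

open scoped Matrix.Norms.L2Operator BigOperators InnerProductSpace ComplexConjugate

namespace Summit.QuantumFields.YangMills.Theorems.Prop7OneFormAgmonExp

open Literature.MathematicalPhysics.QuantumFieldTheory.Balaban1983to89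
open Literature.MathematicalPhysics.QuantumFieldTheory.Balaban1983to89.T3ContinuumYM3Torus
open T3SectALandauChart (formComp eta eta_pos)
open B11Eq103H1Complex (BondL2K)
open Summit.QuantumFields.YangMills.Theorems.Prop7SectET3Transport (periodsT3)
open Summit.QuantumFields.YangMills.Theorems.Prop7SectET3HilbertLetters (W₂ toL2 toL2S DL2)
open Summit.QuantumFields.YangMills.Theorems.Prop7SectET3CurvedPropagators (laplaceA)
open Summit.QuantumFields.YangMills.Theorems.Prop7LaplaceAFlatLetters (norm_sq_toL2)
open Summit.QuantumFields.YangMills.Theorems.Prop7OneFormAgmon (agmon_oneForm_of_letters)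
open Literature.MathematicalPhysics.QuantumFieldTheory.Balaban1983to89.Beta.CombesThomasForm (abs_exp_sub_one_le)

/-! ## §1 Exponential ratio letters -/

variable {F : T3Family} {K : ℕ}

/-- The forward bond ratio of `w = e^{φ}`: `|φ(b₊) − φ(b₋)| ≤ θ ⟹ |w(b₊)∕w(b₋) − 1| ≤ e^θ − 1`. [cite: Balaban1985BackgroundPropagators, Thm 3.1 (3.46) p.398] -/
theorem ratio_exp_le (φ : Site (F.P K) 0 → ℝ) {θ : ℝ} (hφ : ∀ b : PBond (F.P K) 0, |φ b.tgt - φ b.src| ≤ θ) (b : PBond (F.P K) 0) :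
    |Real.exp (φ b.tgt) / Real.exp (φ b.src) - 1| ≤ Real.exp θ - 1 := by
  rw [← Real.exp_sub]; exact abs_exp_sub_one_le (hφ b)

/-- The backward bond ratio: `|w(b₋)∕w(b₊) − 1| ≤ e^θ − 1`. [cite: Balaban1985BackgroundPropagators, Thm 3.1 (3.46) p.398] -/
theorem ratio_exp_le' (φ : Site (F.P K) 0 → ℝ) {θ : ℝ} (hφ : ∀ b : PBond (F.P K) 0, |φ b.tgt - φ b.src| ≤ θ) (b : PBond (F.P K) 0) :
    |Real.exp (φ b.src) / Real.exp (φ b.tgt) - 1| ≤ Real.exp θ - 1 := by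
  rw [← Real.exp_sub]
  refine abs_exp_sub_one_le ?_
  rw [abs_sub_comm]; exact hφ b

/-! ## §2 A3 at exponential weights -/

variable {n : ℕ} {c₀ : ℝ} [Fact (0 < c₀)] {h : n ≤ K} {cB a : ℝ} [Fact (0 < cB)]
  {Δx : GaugeField (F.P K) 0 (Matrix.specialUnitaryGroup (Fin 2) ℂ) → (BondL2K ℂ 3 (periodsT3 F K) c₀ W₂ →ₗ[ℂ] BondL2K ℂ 3 (periodsT3 F K) c₀ W₂)}

/-- ★★ **THE WEIGHTED BOUND AT `w = e^{φ}`**, `|φ(b₊) − φ(b₋)| ≤ θ` on every bond (A3 ✓`agmon_oneForm_of_letters`, `ρ = e^θ − 1`).  At slope `θ = μη` (`η = L^{−(K−n)}`, one fine step):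
`3η⁻²(e^{μη} − 1)² ≤ 3e²μ²` for `μη ≤ 1` — the rate enters K-FREE.  CONDITIONAL on (γ)(C_V)(θ_V). [cite: Balaban1985BackgroundPropagators, Thm 3.1 (3.46) p.398, Thm 3.12 p.422] -/
theorem agmon_oneForm_exp (U₀ : GaugeField (F.P K) 0 (Matrix.specialUnitaryGroup (Fin 2) ℂ)) (φ : Site (F.P K) 0 → ℝ) {θ : ℝ}
    (hφ : ∀ b : PBond (F.P K) 0, |φ b.tgt - φ b.src| ≤ θ)
    {γ CV θV ε : ℝ} (hε : 0 < ε) (hε1 : ε ≤ 1)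
    (hco : ∀ v : BondL2K ℂ 3 (periodsT3 F K) c₀ W₂, γ * ‖v‖ ^ 2 ≤ RCLike.re ⟪v, laplaceA F n K h c₀ cB a Δx U₀ v⟫_ℂ)
    (hVlow : ∀ X : PBond (F.P K) 0 → Matrix (Fin 2) (Fin 2) ℂ,
      -(CV * ‖toL2 F K c₀ X‖ ^ 2) ≤ RCLike.re ⟪toL2 F K c₀ X, laplaceA F n K h c₀ cB a Δx U₀ (toL2 F K c₀ X)⟫_ℂ
        - ∑ μ : Fin (F.P K).d, ‖DL2 F n K c₀ U₀ (toL2S F K c₀ (formComp X μ))‖ ^ 2)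
    (hVconj : ∀ X : PBond (F.P K) 0 → Matrix (Fin 2) (Fin 2) ℂ,
      RCLike.re ⟪toL2 F K c₀ X, laplaceA F n K h c₀ cB a Δx U₀ (toL2 F K c₀ X)⟫_ℂ
          - (∑ μ : Fin (F.P K).d, ‖DL2 F n K c₀ U₀ (toL2S F K c₀ (formComp X μ))‖ ^ 2) - θV * ‖toL2 F K c₀ X‖ ^ 2
        ≤ RCLike.re ⟪toL2 F K c₀ (fun b => Real.exp (φ b.src) • X b), laplaceA F n K h c₀ cB a Δx U₀ (toL2 F K c₀ (fun b => (Real.exp (φ b.src))⁻¹ • X b))⟫_ℂ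
          - RCLike.re (∑ μ : Fin (F.P K).d, ⟪DL2 F n K c₀ U₀ (toL2S F K c₀ (formComp (fun b => Real.exp (φ b.src) • X b) μ)),
              DL2 F n K c₀ U₀ (toL2S F K c₀ (formComp (fun b => (Real.exp (φ b.src))⁻¹ • X b) μ))⟫_ℂ))
    (u f : BondL2K ℂ 3 (periodsT3 F K) c₀ W₂) (hu : laplaceA F n K h c₀ cB a Δx U₀ u = f) :
    ((1 - ε) * γ - ε * CV - 3 * ((eta F n K)⁻¹) ^ 2 * (Real.exp θ - 1) ^ 2 * (1 + 1 / ε) - θV)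
        * ‖toL2 F K c₀ (fun b => Real.exp (φ b.src) • (toL2 F K c₀).symm u b)‖
      ≤ ‖toL2 F K c₀ (fun b => Real.exp (φ b.src) • (toL2 F K c₀).symm f b)‖ :=
  agmon_oneForm_of_letters (h := h) (cB := cB) (a := a) (Δx := Δx) U₀ (fun x => Real.exp (φ x)) (fun _ => Real.exp_pos _)
    (ratio_exp_le φ hφ) (ratio_exp_le' φ hφ) hε hε1 hco hVlow hVconj u f hu

/-! ## §3 The set-to-set (block) decay -/

omit [Fact (0 < cB)] in
/-- **TARGETS WHERE THE WEIGHT IS LARGE**: if `R ≤ φ(b₋)` for every `b ∈ S` then `‖toL2(𝟙_S·X)‖ ≤ e^{−R}·‖toL2(e^{φ∘src}·X)‖`. [cite: Balaban1985BackgroundPropagators, Thm 3.1 (3.46) p.398] -/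
theorem norm_toL2_indicator_le_exp_neg_mul (φ : Site (F.P K) 0 → ℝ) (S : Set (PBond (F.P K) 0)) [DecidablePred (· ∈ S)] {R : ℝ}
    (hS : ∀ b ∈ S, R ≤ φ b.src) (X : PBond (F.P K) 0 → Matrix (Fin 2) (Fin 2) ℂ) :
    ‖toL2 F K c₀ (fun b => if b ∈ S then X b else 0)‖ ≤ Real.exp (-R) * ‖toL2 F K c₀ (fun b => Real.exp (φ b.src) • X b)‖ := by
  have hc₀ : 0 < c₀ := Fact.out
  have hpt : ∀ (b : PBond (F.P K) 0) (i j : Fin 2),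
      ‖(if b ∈ S then X b else 0) i j‖ ^ 2 ≤ Real.exp (-R) ^ 2 * ‖(Real.exp (φ b.src) • X b) i j‖ ^ 2 := by
    intro b i j
    by_cases hb : b ∈ S
    · rw [if_pos hb, Matrix.smul_apply, norm_smul, Real.norm_eq_abs, abs_of_pos (Real.exp_pos _), mul_pow, ← mul_assoc, ← mul_pow, ← Real.exp_add]
      have h1 : 1 ≤ Real.exp (-R + φ b.src) := Real.one_le_exp (by linarith [hS b hb])
      have h2 : 1 ≤ Real.exp (-R + φ b.src) ^ 2 := one_le_pow₀ h1
      nlinarith [sq_nonneg ‖X b i j‖]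
    · rw [if_neg hb, Matrix.zero_apply, norm_zero, zero_pow two_ne_zero]
      positivity
  have hsq : ‖toL2 F K c₀ (fun b => if b ∈ S then X b else 0)‖ ^ 2 ≤ (Real.exp (-R) * ‖toL2 F K c₀ (fun b => Real.exp (φ b.src) • X b)‖) ^ 2 := by
    rw [mul_pow, norm_sq_toL2, norm_sq_toL2]
    have hsum : ∑ b : PBond (F.P K) 0, ∑ i : Fin 2, ∑ j : Fin 2, ‖(if b ∈ S then X b else 0) i j‖ ^ 2
        ≤ ∑ b : PBond (F.P K) 0, ∑ i : Fin 2, ∑ j : Fin 2, Real.exp (-R) ^ 2 * ‖(Real.exp (φ b.src) • X b) i j‖ ^ 2 :=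
      Finset.sum_le_sum fun b _ => Finset.sum_le_sum fun i _ => Finset.sum_le_sum fun j _ => hpt b i j
    have e : ∑ b : PBond (F.P K) 0, ∑ i : Fin 2, ∑ j : Fin 2, Real.exp (-R) ^ 2 * ‖(Real.exp (φ b.src) • X b) i j‖ ^ 2
        = Real.exp (-R) ^ 2 * ∑ b : PBond (F.P K) 0, ∑ i : Fin 2, ∑ j : Fin 2, ‖(Real.exp (φ b.src) • X b) i j‖ ^ 2 := by
      simp_rw [Finset.mul_sum]
    rw [e] at hsum
    have hc := hc₀.le
    nlinarith [hsum, mul_le_mul_of_nonneg_left hsum hc]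
  have h0 : 0 ≤ Real.exp (-R) * ‖toL2 F K c₀ (fun b => Real.exp (φ b.src) • X b)‖ := by positivity
  exact (pow_le_pow_iff_left₀ (norm_nonneg _) h0 two_ne_zero).mp hsq

omit [Fact (0 < c₀)] [Fact (0 < cB)] in
/-- **SOURCES WHERE THE WEIGHT IS ONE**: if `φ(b₋) = 0` wherever `X b ≠ 0` then `e^{φ∘src}·X = X`. [cite: Balaban1985BackgroundPropagators, Thm 3.1 (3.42) p.397 («supp λ ⊂ Δ(y′)»)] -/
theorem smul_exp_eq_of_support (φ : Site (F.P K) 0 → ℝ) (X : PBond (F.P K) 0 → Matrix (Fin 2) (Fin 2) ℂ)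
    (hX : ∀ b, X b ≠ 0 → φ b.src = 0) :
    (fun b => Real.exp (φ b.src) • X b) = X := by
  funext b
  by_cases hb : X b = 0
  · rw [hb, smul_zero]
  · rw [hX b hb, Real.exp_zero, one_smul]

/-- ★★★ **THE BLOCK-`L²` (SET-TO-SET) DECAY OF THE ONE-FORM GREEN's FUNCTION, MODULO A3's LETTERS**: `Δ_a u = f` with `f = toL2 X_f`, `X_f` supported in `{b : φ(b₋) = 0}`, a weight exponent
`φ` with `|φ(b₊) − φ(b₋)| ≤ θ`, and a target set `S` of bonds with `φ(b₋) ≥ R` on `S`: `((1−ε)γ − εC_V − 3η⁻²(e^θ−1)²(1+1∕ε) − θ_V)·‖toL2(𝟙_S·toL2⁻¹u)‖ ≤ e^{−R}·‖f‖` — the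
(3.46)-class decay `e^{−δ₀·d(target, source)}` of `G(U₀) = Δ_a⁻¹` at the member when `φ = μη·dist_fine(·, supp f)` (so `R ≈ μ·tdist` in blocks).  CONDITIONAL on (γ)(C_V)(θ_V) and on the
bracket being positive. [cite: Balaban1985BackgroundPropagators, Thm 3.1 (3.46) p.398, Thm 3.12 p.422] -/
theorem blockDecay_oneForm_of_letters (U₀ : GaugeField (F.P K) 0 (Matrix.specialUnitaryGroup (Fin 2) ℂ)) (φ : Site (F.P K) 0 → ℝ) {θ : ℝ}
    (hφ : ∀ b : PBond (F.P K) 0, |φ b.tgt - φ b.src| ≤ θ)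
    {γ CV θV ε : ℝ} (hε : 0 < ε) (hε1 : ε ≤ 1)
    (hco : ∀ v : BondL2K ℂ 3 (periodsT3 F K) c₀ W₂, γ * ‖v‖ ^ 2 ≤ RCLike.re ⟪v, laplaceA F n K h c₀ cB a Δx U₀ v⟫_ℂ)
    (hVlow : ∀ X : PBond (F.P K) 0 → Matrix (Fin 2) (Fin 2) ℂ,
      -(CV * ‖toL2 F K c₀ X‖ ^ 2) ≤ RCLike.re ⟪toL2 F K c₀ X, laplaceA F n K h c₀ cB a Δx U₀ (toL2 F K c₀ X)⟫_ℂ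
        - ∑ μ : Fin (F.P K).d, ‖DL2 F n K c₀ U₀ (toL2S F K c₀ (formComp X μ))‖ ^ 2)
    (hVconj : ∀ X : PBond (F.P K) 0 → Matrix (Fin 2) (Fin 2) ℂ,
      RCLike.re ⟪toL2 F K c₀ X, laplaceA F n K h c₀ cB a Δx U₀ (toL2 F K c₀ X)⟫_ℂ
          - (∑ μ : Fin (F.P K).d, ‖DL2 F n K c₀ U₀ (toL2S F K c₀ (formComp X μ))‖ ^ 2) - θV * ‖toL2 F K c₀ X‖ ^ 2
        ≤ RCLike.re ⟪toL2 F K c₀ (fun b => Real.exp (φ b.src) • X b), laplaceA F n K h c₀ cB a Δx U₀ (toL2 F K c₀ (fun b => (Real.exp (φ b.src))⁻¹ • X b))⟫_ℂ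
          - RCLike.re (∑ μ : Fin (F.P K).d, ⟪DL2 F n K c₀ U₀ (toL2S F K c₀ (formComp (fun b => Real.exp (φ b.src) • X b) μ)),
              DL2 F n K c₀ U₀ (toL2S F K c₀ (formComp (fun b => (Real.exp (φ b.src))⁻¹ • X b) μ))⟫_ℂ))
    (hΘ : 0 ≤ (1 - ε) * γ - ε * CV - 3 * ((eta F n K)⁻¹) ^ 2 * (Real.exp θ - 1) ^ 2 * (1 + 1 / ε) - θV)
    (Xf : PBond (F.P K) 0 → Matrix (Fin 2) (Fin 2) ℂ) (hXf : ∀ b, Xf b ≠ 0 → φ b.src = 0)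
    (u : BondL2K ℂ 3 (periodsT3 F K) c₀ W₂) (hu : laplaceA F n K h c₀ cB a Δx U₀ u = toL2 F K c₀ Xf)
    (S : Set (PBond (F.P K) 0)) [DecidablePred (· ∈ S)] {R : ℝ} (hS : ∀ b ∈ S, R ≤ φ b.src) :
    ((1 - ε) * γ - ε * CV - 3 * ((eta F n K)⁻¹) ^ 2 * (Real.exp θ - 1) ^ 2 * (1 + 1 / ε) - θV)
        * ‖toL2 F K c₀ (fun b => if b ∈ S then (toL2 F K c₀).symm u b else 0)‖
      ≤ Real.exp (-R) * ‖toL2 F K c₀ Xf‖ := by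
  have hA := agmon_oneForm_exp (h := h) (cB := cB) (a := a) (Δx := Δx) U₀ φ hφ hε hε1 hco hVlow hVconj u (toL2 F K c₀ Xf) hu
  rw [LinearEquiv.symm_apply_apply, smul_exp_eq_of_support φ Xf hXf] at hA
  have hT := norm_toL2_indicator_le_exp_neg_mul (c₀ := c₀) φ S hS ((toL2 F K c₀).symm u)
  have hR : 0 ≤ Real.exp (-R) := (Real.exp_pos _).le
  calc ((1 - ε) * γ - ε * CV - 3 * ((eta F n K)⁻¹) ^ 2 * (Real.exp θ - 1) ^ 2 * (1 + 1 / ε) - θV)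
          * ‖toL2 F K c₀ (fun b => if b ∈ S then (toL2 F K c₀).symm u b else 0)‖
        ≤ ((1 - ε) * γ - ε * CV - 3 * ((eta F n K)⁻¹) ^ 2 * (Real.exp θ - 1) ^ 2 * (1 + 1 / ε) - θV)
          * (Real.exp (-R) * ‖toL2 F K c₀ (fun b => Real.exp (φ b.src) • (toL2 F K c₀).symm u b)‖) := mul_le_mul_of_nonneg_left hT hΘ
      _ = Real.exp (-R) * (((1 - ε) * γ - ε * CV - 3 * ((eta F n K)⁻¹) ^ 2 * (Real.exp θ - 1) ^ 2 * (1 + 1 / ε) - θV)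
          * ‖toL2 F K c₀ (fun b => Real.exp (φ b.src) • (toL2 F K c₀).symm u b)‖) := by ring
      _ ≤ Real.exp (-R) * ‖toL2 F K c₀ Xf‖ := mul_le_mul_of_nonneg_left hA hR

end Summit.QuantumFields.YangMills.Theorems.Prop7OneFormAgmonExp

end
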